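import Summits.QuantumFields.YangMills.Theses.SoftLoopLongLag
import Summits.QuantumFields.YangMills.Theorems.SoftLoopLongLagDefs
import Summits.QuantumFields.YangMills.Theorems.SoftLoopLongLagColdBoxSoftLoopLagFloorStubGaussCore
import Summits.QuantumFields.YangMills.Theorems.SoftLoopLongLagSoftLoopLagFloorToTorusDlrTransferPlumbingG
import Summits.QuantumFields.YangMills.Theorems.ColdBoxAllGroupsDefs
import Summits.QuantumFields.YangMills.Theorems.SoftLoopLongLagColdBoxInnerMixtureG
import HarnessLib
import HarnessLib.Audit

/-!
# Skeleton v7 (lead `ym-line-sll-p1`; crux T′ rev 3 = stmt-QuantumFields-24180) — E-ARCHITECTURE: inner cold-wall box on the sibling engine's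
# geometry + in-box DLR mixture (P_T LANDED by ym-line-sll-p3: `coldBoxFloor_of_innerMixture`; three analytic stubs E1a, E1b, E2 remain) — `Cruxes/ColdBoxSoftLoopLagFloor/Lines/birth.lean`, route `SoftLoopLongLag`

HONEST LABEL.  Rung R2xi-G of LADDER-YM (leaf `WeakCouplingRates.XiPow`: an UPPER bound `m ≤ β^{-ε}` on the lattice mass gap of
every torus-limit state, all compact simple `G`) — RECORD label, NOT the Clay mass gap; no summit statement is touched.

THE CRUX (T′ rev 3).  For every compact simple `G`, `r` there are `c, ε₀ > 0` such that for every `ε ≤ ε₀` there are `κ ∈ (0, ε]`, `β₀` with: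
for `β ≥ β₀` and every datum `η` which is crude-good at scale `κ/2` on the box `Λ = [-n,n]⁴ × {dirs}`, `n = ⌈β^{8ε}⌉`, and whose kernel is
exponentially cold-typical (`γ_Λ(·|η)(coldᶜ) ≤ exp(−β^{κ/4})`, cold = every plaquette touching `Λ` costs `≤ β^{κ−1}`), the cold-conditioned
kernel `ν` has `Cov_ν(F, F∘α_R) ≥ c·R³·β^{-2}`, `F` = cube-smeared time-zero soft loops of side `R = ⌈β^ε⌉`, `α_R` = time shift.

THE LINE v7 (E-architecture; why: the analytic one-scale work is moved onto the EXACT geometry of the sibling route `ColdBoxAllGroups`' engine —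
corner cube `[0,2H]⁴`, free links `AxialGauge.boxEdges 4 (2H+1)`, kernel `boxKernelG r.ρ β H ζ`, data `CrudeGoodG` —
so that its exponential chart / forest gauge / Laplace expansion (`ColdBoxAllGroupsOneScaleDefs`, `expChart`) is reused verbatim with the loop
observable TRANSLATED to the box centre, `F_sh U = softLoopObs r R (configShift (−boxCentre H) U)`; the passage from the inner box `H = ⌈β^{31ε/4}⌉`
to the crux's conditioned outer kernel on `lagBox ⌈β^{8ε}⌉` is pure DLR plumbing, isolated in ONE stub P_T):
* **S1 `stub_gaussCore`** — CLOSED (p586428): Wick floor `c₁·R³ ≤ wickLagSum R R`.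
* **E1a `stub_innerFlatLagFloorG`** (general `G`, FLAT datum, UNCONDITIONED inner kernel = the sibling's `boxState`): `β²·Cov_{box H, η≡1}(F_sh, F_sh∘α_R)
  ≥ d·wickLagSum R R − β^{-γ}R³` for `a ∈ [4ε, a₀]`, `H = ⌈β^a⌉` (zero background ⇒ no linear term; Dirichlet-vs-free inductance correction `(R/H)⁴`).
* **E1b `stub_innerDatumCovStabilityG`** (LOAD-BEARING, general `G`): for inner data `ζ` crude-good at scale `κ/2` (`CrudeGoodG r.ρ β (κ/2) H ζ`: every
  plaquette in the corona range costs `≤ β^{κ−1}`) whose kernel is cold-typical (`boxKernelG … ζ (cold_{2κ}(inner))ᶜ ≤ exp(−β^{κ/8})`, threshold `β^{2κ−1}` as in the landed P_T), the lag covariance is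
  at least HALF the flat one minus the background price `C·R¹²·β^κ/H²` (landed G-free layer: lag positivity `SoftLoopLongLagFreeMaxwellLagPositivity`,
  odd-weight cancellation `SoftLoopLongLagInductanceSymmetry`, `Σ|M| = O(#cube²)` `SoftLoopLongLagInductanceBounds`, loop-cost cubic `SoftLoopLongLagLoopCostCubic`)
  minus `β^{-γ}R³`; `κ ≤ ε/2` allowed.
* **E2 `stub_innerDatumMeanSmoothG`** (general `G`): for the same data, `|E_ζ F_sh∘α_R − E_ζ F_sh| ≤ K·R⁸·β^{κ−1}/H` (interior smoothness of the
  background = minimal-action extension; also consumed by K′'s K2).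
* **P_T — LANDED** (ym-line-sll-p3, `Theorems/SoftLoopLongLagColdBoxInnerMixtureG.lean`, `coldBoxFloor_of_innerMixture`, used BY NAME; inner cold-typicality at threshold `2κ`): inner floor `c·R³β^{-2}` for good typical inner data (shape of E1) ∧ inner mean
  smoothness (shape of E2) ⇒ the crux's conclusion with constant `c/8`: drop the conditioning (`|Cov_ν − Cov_γ| ≤ 6B²γ(hot)/(1−γ(hot))`, `B = (2R+1)⁴`),
  DLR consistency `γ_Λ(·|η) = ∫ γ_{inner}(·|ζ) γ_Λ(dζ|η)` (tree `isSpecification_ymSpecification_of_t2Space`) read through the translation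
  `ymSpecification_map_configShift`, inner data are crude-good on the outer cold event and typical off a Markov-small set
  (`E_ζ γ'_ζ(hot_in) = γ(hot_in) ≤ γ(hot_out)`), law of total covariance `Cov_γ = E_ζ Cov_{γ'_ζ} + Cov_ζ(m_F, m_{F∘α}) ≥ E_ζ Cov_{γ'_ζ} − ½E_ζ(m_F − m_{F∘α})²`;
  sizes: `R¹³β^{2κ}/H² ≤ 2¹³β^{2κ−5ε/2} → 0` (`κ ≤ ε`; the inner exponent `31ε/4 ∈ (15ε/2, 8ε)` is what makes BOTH this and `H < n` hold), `[−H−1, H+1]⁴`-based plaquettes touch `Λ`, `H + 3R ≤ n`.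
* Compositions (kernel-checked): `innerFloor_lineForm` (S1 ∧ E1a ∧ E1b ⇒ inner floor `(dc₁/4)·R³β^{-2}`, `a = 31ε/4`, price `4096·C·β^{-3ε}` absorbed),
  `coldBoxFloor_lineForm` (∧ E2 ∧ P_T ⇒ outer floor `(dc₁/32)·R³β^{-2}`), `ColdBoxSoftLoopLagFloor_of_stubs` (the crux BY NAME through its `let`s).
Superseded v5 stubs `stub_coldWallLoopLagFloorG` / `stub_datumStabilityLoopG` (lagBox geometry) are withdrawn (nobody had landed them).

OBJECTS: `softLoopObs`, `lagBox`, `coldEvent`, `coldKernel`, `lagCov`, `wickLagSum`, … = tree `Theorems/SoftLoopLongLagDefs.lean`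
(namespace `…Theorems.SoftLoopLongLag`); `boxKernelG`, `CrudeGoodG` = `Theorems/ColdBoxAllGroupsDefs.lean`; `boxCentre` = `WeakCouplingRates`;
`configShift` = `LatticeGaugeDLR`.  Stub files import those modules (never this file / the Theses file) and prove the stub BY NAME + SIGNATURE.
-/

set_option autoImplicit false

noncomputable section

namespace Summit.QuantumFields.YangMills.Cruxes.ColdBoxSoftLoopLagFloor.Birth

open MeasureTheory Filter Topology
open Literature.Probability.LatticeModels (Site box)
open Literature.MathematicalPhysics Literature.MathematicalPhysics.QuantumFieldTheory
open Literature.MathematicalPhysics.QuantumLattice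
open Summit.QuantumFields.YangMills.Theorems.WeakCouplingRates
open Summit.QuantumFields.YangMills.Theorems.SoftLoopLongLag
open Summit.QuantumFields.YangMills.Theorems.ColdBoxAllGroups (boxKernelG CrudeGoodG)

/-! ## The stubs -/

/-- **S1 `stub_gaussCore` — CLOSED** (seat ym-line-sll-p2, p586428, `Theorems/SoftLoopLongLagColdBoxSoftLoopLagFloorStubGaussCore.lean`):
the landed tree theorem BY NAME.  The Wick floor `c·R³ ≤ wickLagSum R R` for `R ≥ R₀` (time-coaxial pairs, diagonal inductance floor from the
`ℤ⁴` Green-function asymptotics). -/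
theorem stub_gaussCore : ∃ c : ℝ, 0 < c ∧ ∃ R₀ : ℕ, ∀ R : ℕ, R₀ ≤ R → c * (R : ℝ) ^ 3 ≤ wickLagSum R R :=
  Summit.QuantumFields.YangMills.Theorems.SoftLoopLongLag.stub_gaussCore

/-- **E1a `stub_innerFlatLagFloorG`** (general `G`, FLAT datum, unconditioned inner kernel on the sibling geometry): for the cold-wall box
`[0,2H]⁴`, `H = ⌈β^a⌉`, `a ∈ [4ε, a₀]`, the translated soft-loop observable has `β²·Cov(F_sh, F_sh∘α_R) ≥ d·wickLagSum R R − β^{-γ}R³`. -/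
theorem stub_innerFlatLagFloorG :
    ∀ (G : Type) [Group G] [TopologicalSpace G] [IsTopologicalGroup G] [CompactSpace G] [MeasurableSpace G] [BorelSpace G],
    IsCompactSimpleLieGroup G → ∀ r : LatticeRep G, ∃ d a₀ : ℝ, 0 < d ∧ 0 < a₀ ∧
      ∀ ε a : ℝ, 0 < ε → 4 * ε ≤ a → a ≤ a₀ → ∃ γ β₀ : ℝ, 0 < γ ∧
        ∀ β : ℝ, β₀ ≤ β →
          d * wickLagSum ⌈β ^ ε⌉₊ ⌈β ^ ε⌉₊ - β ^ (-γ) * (⌈β ^ ε⌉₊ : ℝ) ^ 3 ≤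
            β ^ 2 * lagCov (boxKernelG r.ρ β ⌈β ^ a⌉₊ (fun _ => 1))
              (fun U => softLoopObs r ⌈β ^ ε⌉₊ (configShift (-(boxCentre ⌈β ^ a⌉₊)) U)) ⌈β ^ ε⌉₊ := by
  sorry

/-- **E1b `stub_innerDatumCovStabilityG`** (LOAD-BEARING, general `G`): for inner data `ζ` crude-good at scale `κ/2` whose kernel is cold-typical,
the lag-`R` autocovariance of the translated observable is at least HALF the flat one, up to the background price `C·R¹²·β^κ/H²` and `β^{-γ}R³`. -/
theorem stub_innerDatumCovStabilityG :
    ∀ (G : Type) [Group G] [TopologicalSpace G] [IsTopologicalGroup G] [CompactSpace G] [MeasurableSpace G] [BorelSpace G],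
    IsCompactSimpleLieGroup G → ∀ r : LatticeRep G, ∃ C a₁ κ₁ : ℝ, 0 < C ∧ 0 < a₁ ∧ 0 < κ₁ ∧
      ∀ ε a κ : ℝ, 0 < ε → 4 * ε ≤ a → a ≤ a₁ → 0 < κ → κ ≤ κ₁ → κ ≤ ε / 2 → ∃ γ β₀ : ℝ, 0 < γ ∧
        ∀ β : ℝ, β₀ ≤ β → ∀ ζ : LGConfig 4 G,
          CrudeGoodG r.ρ β (κ / 2) ⌈β ^ a⌉₊ ζ →
          boxKernelG r.ρ β ⌈β ^ a⌉₊ ζ (coldEvent r β (2 * κ) (AxialGauge.boxEdges 4 (2 * ⌈β ^ a⌉₊ + 1)))ᶜ ≤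
            ENNReal.ofReal (Real.exp (-(β ^ (κ / 8)))) →
          2⁻¹ * (β ^ 2 * lagCov (boxKernelG r.ρ β ⌈β ^ a⌉₊ (fun _ => 1))
              (fun U => softLoopObs r ⌈β ^ ε⌉₊ (configShift (-(boxCentre ⌈β ^ a⌉₊)) U)) ⌈β ^ ε⌉₊) -
              C * (⌈β ^ ε⌉₊ : ℝ) ^ 12 * β ^ κ / (⌈β ^ a⌉₊ : ℝ) ^ 2 - β ^ (-γ) * (⌈β ^ ε⌉₊ : ℝ) ^ 3 ≤
            β ^ 2 * lagCov (boxKernelG r.ρ β ⌈β ^ a⌉₊ ζ)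
              (fun U => softLoopObs r ⌈β ^ ε⌉₊ (configShift (-(boxCentre ⌈β ^ a⌉₊)) U)) ⌈β ^ ε⌉₊ := by
  sorry

/-- **E2 `stub_innerDatumMeanSmoothG`** (general `G`): for the same inner data, the kernel means of `F_sh` and `F_sh∘α_R` differ by at most
`K·R⁸·β^{κ−1}/H` (interior smoothness of the minimal-action extension of the datum at distance `≍ H` from the wall). -/
theorem stub_innerDatumMeanSmoothG :
    ∀ (G : Type) [Group G] [TopologicalSpace G] [IsTopologicalGroup G] [CompactSpace G] [MeasurableSpace G] [BorelSpace G],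
    IsCompactSimpleLieGroup G → ∀ r : LatticeRep G, ∃ K a₂ κ₂ : ℝ, 0 < K ∧ 0 < a₂ ∧ 0 < κ₂ ∧
      ∀ ε a κ : ℝ, 0 < ε → 4 * ε ≤ a → a ≤ a₂ → 0 < κ → κ ≤ κ₂ → ∃ β₀ : ℝ,
        ∀ β : ℝ, β₀ ≤ β → ∀ ζ : LGConfig 4 G,
          CrudeGoodG r.ρ β (κ / 2) ⌈β ^ a⌉₊ ζ →
          boxKernelG r.ρ β ⌈β ^ a⌉₊ ζ (coldEvent r β (2 * κ) (AxialGauge.boxEdges 4 (2 * ⌈β ^ a⌉₊ + 1)))ᶜ ≤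
            ENNReal.ofReal (Real.exp (-(β ^ (κ / 8)))) →
          |(∫ U, softLoopObs r ⌈β ^ ε⌉₊ (configShift (-(boxCentre ⌈β ^ a⌉₊)) (timeShiftLG (G := G) ⌈β ^ ε⌉₊ U))
                ∂(boxKernelG r.ρ β ⌈β ^ a⌉₊ ζ)) -
              ∫ U, softLoopObs r ⌈β ^ ε⌉₊ (configShift (-(boxCentre ⌈β ^ a⌉₊)) U) ∂(boxKernelG r.ρ β ⌈β ^ a⌉₊ ζ)| ≤
            K * (⌈β ^ ε⌉₊ : ℝ) ^ 8 * β ^ (κ - 1) / (⌈β ^ a⌉₊ : ℝ) := by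
  sorry

/-! ## Compositions (kernel-checked): S1 ∧ E1a ∧ E1b ⇒ inner floor; ∧ E2 ∧ P_T (LANDED, ym-line-sll-p3: `coldBoxFloor_of_innerMixture`) ⇒ T′ (rev 3, stmt-QuantumFields-24180) BY NAME -/

/-- Threshold bookkeeping: for `ε > 0` and any real `K`, eventually `K ≤ ⌈β^ε⌉₊`. -/
theorem eventually_le_ceil_rpow {ε : ℝ} (hε : 0 < ε) (K : ℝ) : ∀ᶠ β : ℝ in atTop, K ≤ (⌈β ^ ε⌉₊ : ℝ) := by
  filter_upwards [(tendsto_rpow_atTop hε).eventually_ge_atTop K] with β hβ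
  exact hβ.trans (Nat.le_ceil _)

/-- INNER FLOOR (S1 ∧ E1a ∧ E1b): explicit floor `c·R³·β^{-2}`, `c := d·c₁/4`, inner half-side `H = ⌈β^{31ε/4}⌉`, every `ε ≤ ε₀ := 4·min a₀ a₁/31`,
every `κ ≤ min κ₁ (ε/2)`.  Bookkeeping: `R ≤ 2β^ε`, `H ≥ β^{31ε/4}`, `β^κ ≤ β^{ε/2}` ⇒ background price `≤ 4096·C·β^{-3ε} ≤ (dc₁/8)·R³` eventually,
`½β^{-γ₁} + β^{-γ₂} ≤ dc₁/8` eventually, so `β²·Cov_ζ ≥ ½(d·c₁R³ − β^{-γ₁}R³) − price − β^{-γ₂}R³ ≥ (dc₁/4)R³`. -/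
theorem innerFloor_lineForm :
    ∀ (G : Type) [Group G] [TopologicalSpace G] [IsTopologicalGroup G] [CompactSpace G] [MeasurableSpace G] [BorelSpace G],
    IsCompactSimpleLieGroup G → ∀ r : LatticeRep G, ∃ c ε₀ κ₁ : ℝ, 0 < c ∧ 0 < ε₀ ∧ 0 < κ₁ ∧
      ∀ ε κ : ℝ, 0 < ε → ε ≤ ε₀ → 0 < κ → κ ≤ κ₁ → κ ≤ ε / 2 → ∃ β₀ : ℝ,
        ∀ β : ℝ, β₀ ≤ β → ∀ ζ : LGConfig 4 G,
          CrudeGoodG r.ρ β (κ / 2) ⌈β ^ (31 / 4 * ε)⌉₊ ζ →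
          boxKernelG r.ρ β ⌈β ^ (31 / 4 * ε)⌉₊ ζ
              (coldEvent r β (2 * κ) (AxialGauge.boxEdges 4 (2 * ⌈β ^ (31 / 4 * ε)⌉₊ + 1)))ᶜ ≤ ENNReal.ofReal (Real.exp (-(β ^ (κ / 8)))) →
          c * (⌈β ^ ε⌉₊ : ℝ) ^ 3 * β ^ (-(2 : ℝ)) ≤
            lagCov (boxKernelG r.ρ β ⌈β ^ (31 / 4 * ε)⌉₊ ζ)
              (fun U => softLoopObs r ⌈β ^ ε⌉₊ (configShift (-(boxCentre ⌈β ^ (31 / 4 * ε)⌉₊)) U)) ⌈β ^ ε⌉₊ := by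
  intro G _ _ _ _ _ _ hG r
  obtain ⟨c₁, hc₁, R₀, hS1⟩ := stub_gaussCore
  obtain ⟨d, a₀, hd, ha₀, hE1a⟩ := stub_innerFlatLagFloorG G hG r
  obtain ⟨C, a₁, κ₁, hC, ha₁, hκ₁, hE1b⟩ := stub_innerDatumCovStabilityG G hG r
  have hdc : 0 < d * c₁ := mul_pos hd hc₁
  refine ⟨d * c₁ / 4, 4 * min a₀ a₁ / 31, κ₁, by positivity, by have := lt_min ha₀ ha₁; positivity, hκ₁,
    fun ε κ hε hεle hκpos hκ1 hκε => ?_⟩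
  have ha₀' : 31 / 4 * ε ≤ a₀ := by have := min_le_left a₀ a₁; linarith
  have ha₁' : 31 / 4 * ε ≤ a₁ := by have := min_le_right a₀ a₁; linarith
  have h4 : 4 * ε ≤ 31 / 4 * ε := by linarith
  obtain ⟨γ₁, β₁, hγ₁, hA⟩ := hE1a ε (31 / 4 * ε) hε h4 ha₀'
  obtain ⟨γ₂, β₂, hγ₂, hB⟩ := hE1b ε (31 / 4 * ε) κ hε h4 ha₁' hκpos hκ1 hκε
  -- thresholds in `β`
  have hε3 : 0 < 3 * ε := by positivity
  have T0 : ∀ᶠ β : ℝ in atTop, (R₀ : ℝ) ≤ (⌈β ^ ε⌉₊ : ℝ) := eventually_le_ceil_rpow hε R₀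
  have T1 : ∀ᶠ β : ℝ in atTop, 4096 * C * (8 / (d * c₁)) ≤ β ^ (3 * ε) := (tendsto_rpow_atTop hε3).eventually_ge_atTop _
  have T2 : ∀ᶠ β : ℝ in atTop, β ^ (-γ₁) ≤ d * c₁ / 8 := (tendsto_rpow_neg_atTop hγ₁).eventually (eventually_le_nhds (by positivity))
  have T3 : ∀ᶠ β : ℝ in atTop, β ^ (-γ₂) ≤ d * c₁ / 16 := (tendsto_rpow_neg_atTop hγ₂).eventually (eventually_le_nhds (by positivity))
  obtain ⟨β₃, hβ₃⟩ := eventually_atTop.1 (T0.and (T1.and (T2.and (T3.and (eventually_ge_atTop 1)))))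
  refine ⟨max (max β₁ β₂) β₃, fun β hβ ζ hgood htyp => ?_⟩
  have hβ1 : β₁ ≤ β := ((le_max_left _ _).trans (le_max_left _ _)).trans hβ
  have hβ2 : β₂ ≤ β := ((le_max_right _ _).trans (le_max_left _ _)).trans hβ
  obtain ⟨hR₀, hT1, hT2, hT3, hβone⟩ := hβ₃ β ((le_max_right _ _).trans hβ)
  have hβ0 : 0 < β := one_pos.trans_le hβone
  set R : ℕ := ⌈β ^ ε⌉₊ with hRdef
  set n : ℕ := ⌈β ^ (31 / 4 * ε)⌉₊ with hndef
  set W : ℝ := wickLagSum R R with hWdef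
  set X₁ : ℝ := β ^ 2 * lagCov (boxKernelG r.ρ β n (fun _ => 1))
    (fun U => softLoopObs r R (configShift (-(boxCentre n)) U)) R with hX₁
  set Xη : ℝ := β ^ 2 * lagCov (boxKernelG r.ρ β n ζ)
    (fun U => softLoopObs r R (configShift (-(boxCentre n)) U)) R with hXη
  have hAβ : d * W - β ^ (-γ₁) * (R : ℝ) ^ 3 ≤ X₁ := hA β hβ1
  have hBβ : 2⁻¹ * X₁ - C * (R : ℝ) ^ 12 * β ^ κ / (n : ℝ) ^ 2 - β ^ (-γ₂) * (R : ℝ) ^ 3 ≤ Xη := hB β hβ2 ζ hgood htyp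
  -- sizes of `R`, `n`, `β^κ`
  have hβε1 : (1 : ℝ) ≤ β ^ ε := Real.one_le_rpow hβone hε.le
  have hR1 : (1 : ℝ) ≤ (R : ℝ) := hβε1.trans (Nat.le_ceil _)
  have hR0 : (0 : ℝ) < (R : ℝ) := one_pos.trans_le hR1
  have hR3 : (1 : ℝ) ≤ (R : ℝ) ^ 3 := one_le_pow₀ hR1
  have hRle : (R : ℝ) ≤ 2 * β ^ ε := by
    have := (Nat.ceil_lt_add_one (zero_le_one.trans hβε1)).le
    rw [hRdef]; linarith
  have hnge : β ^ (31 / 4 * ε) ≤ (n : ℝ) := Nat.le_ceil _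
  have hn0 : (0 : ℝ) < (n : ℝ) := lt_of_lt_of_le (Real.rpow_pos_of_pos hβ0 _) hnge
  have hβκ : β ^ κ ≤ β ^ (ε / 2) := Real.rpow_le_rpow_of_exponent_le hβone hκε
  have hR₀' : R₀ ≤ R := by exact_mod_cast hR₀
  have hW : c₁ * (R : ℝ) ^ 3 ≤ W := hS1 R hR₀'
  -- (1) the background price is at most `(dc₁/8)·R³`
  have hprice : C * (R : ℝ) ^ 12 * β ^ κ / (n : ℝ) ^ 2 ≤ d * c₁ / 8 * (R : ℝ) ^ 3 := by
    have hR12 : (R : ℝ) ^ 12 ≤ 4096 * β ^ (12 * ε) := by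
      have h := pow_le_pow_left₀ hR0.le hRle 12
      have hβε12 : (β ^ ε) ^ 12 = β ^ (12 * ε) := by
        rw [← Real.rpow_natCast, ← Real.rpow_mul hβ0.le]; ring_nf
      calc (R : ℝ) ^ 12 ≤ (2 * β ^ ε) ^ 12 := h
        _ = 4096 * (β ^ ε) ^ 12 := by ring
        _ = 4096 * β ^ (12 * ε) := by rw [hβε12]
    have hn2 : β ^ (31 / 2 * ε) ≤ (n : ℝ) ^ 2 := by
      have h := pow_le_pow_left₀ (Real.rpow_nonneg hβ0.le _) hnge 2
      have hβ16 : (β ^ (31 / 4 * ε)) ^ 2 = β ^ (31 / 2 * ε) := by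
        rw [← Real.rpow_natCast, ← Real.rpow_mul hβ0.le]; ring_nf
      rwa [hβ16] at h
    -- `C R¹² β^κ ≤ 4096 C β^{12ε} β^{ε/2}` and `(dc₁/8) R³ n² ≥ (dc₁/8) β^{15ε}`; compare with `T1`
    rw [div_le_iff₀ (by positivity)]
    have hsplit : β ^ (31 / 2 * ε) = β ^ (12 * ε) * β ^ (ε / 2) * β ^ (3 * ε) := by
      rw [← Real.rpow_add hβ0, ← Real.rpow_add hβ0]; ring_nf
    have hT1' : 4096 * C ≤ d * c₁ / 8 * β ^ (3 * ε) := by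
      have := (div_le_iff₀ (show (0 : ℝ) < d * c₁ by positivity)).1
        (show 4096 * C * 8 / (d * c₁) ≤ β ^ (3 * ε) by rw [mul_div_assoc]; exact hT1)
      linarith
    calc C * (R : ℝ) ^ 12 * β ^ κ ≤ C * (4096 * β ^ (12 * ε)) * β ^ (ε / 2) :=
          mul_le_mul (mul_le_mul_of_nonneg_left hR12 hC.le) hβκ (Real.rpow_nonneg hβ0.le _) (by positivity)
      _ = (4096 * C) * (β ^ (12 * ε) * β ^ (ε / 2)) := by ring
      _ ≤ (d * c₁ / 8 * β ^ (3 * ε)) * (β ^ (12 * ε) * β ^ (ε / 2)) :=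
          mul_le_mul_of_nonneg_right hT1' (by positivity)
      _ = d * c₁ / 8 * 1 * β ^ (31 / 2 * ε) := by rw [hsplit]; ring
      _ ≤ d * c₁ / 8 * (R : ℝ) ^ 3 * (n : ℝ) ^ 2 := by
          have := mul_le_mul (mul_le_mul_of_nonneg_left hR3 (by positivity : (0 : ℝ) ≤ d * c₁ / 8)) hn2
            (Real.rpow_nonneg hβ0.le _) (by positivity)
          exact this
  -- (2) the relative errors
  have herr₁ : 2⁻¹ * (β ^ (-γ₁) * (R : ℝ) ^ 3) ≤ d * c₁ / 16 * (R : ℝ) ^ 3 := by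
    have := mul_le_mul_of_nonneg_right hT2 (by positivity : (0 : ℝ) ≤ (R : ℝ) ^ 3)
    linarith
  have herr₂ : β ^ (-γ₂) * (R : ℝ) ^ 3 ≤ d * c₁ / 16 * (R : ℝ) ^ 3 :=
    mul_le_mul_of_nonneg_right hT3 (by positivity)
  -- assemble: `β²·Cov_η ≥ (dc₁/4) R³`
  have hdW : d * (c₁ * (R : ℝ) ^ 3) ≤ d * W := mul_le_mul_of_nonneg_left hW hd.le
  have hkey : d * c₁ / 4 * (R : ℝ) ^ 3 ≤ Xη := by linarith [hAβ, hBβ, hprice, herr₁, herr₂, hdW]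
  -- divide by `β²`
  have hβ2 : 0 < β ^ (2 : ℕ) := pow_pos hβ0 2
  rw [Real.rpow_neg hβ0.le, Real.rpow_two]
  rw [show d * c₁ / 4 * (R : ℝ) ^ 3 * (β ^ 2)⁻¹ = (d * c₁ / 4 * (R : ℝ) ^ 3) / β ^ 2 by ring,
    div_le_iff₀ hβ2]
  simpa only [hXη, mul_comm] using hkey

/-- OUTER FLOOR (inner floor ∧ E2 ∧ the LANDED in-box mixture `Theorems.SoftLoopLongLag.coldBoxFloor_of_innerMixture`, ym-line-sll-p3): the crux's shape with
`c' := c/8`, every `ε ≤ min ε₀ (4a₂/31)`, `κ := min (min κ₁ κ₂) (min (ε/2) (1/2))`; window `13ε + 2κ < 2·(31ε/4)` (from `κ ≤ ε/2`), `31ε/4 < 8ε`. -/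
theorem coldBoxFloor_lineForm :
    ∀ (G : Type) [Group G] [TopologicalSpace G] [IsTopologicalGroup G] [CompactSpace G] [MeasurableSpace G] [BorelSpace G],
    IsCompactSimpleLieGroup G → ∀ r : LatticeRep G, ∃ c ε₀ : ℝ, 0 < c ∧ 0 < ε₀ ∧
      ∀ ε : ℝ, 0 < ε → ε ≤ ε₀ → ∃ κ β₀ : ℝ, 0 < κ ∧ κ ≤ ε ∧ κ < 1 ∧
        ∀ β : ℝ, β₀ ≤ β → ∀ η : LGConfig 4 G,
          (∀ p ∈ plaquettesTouching (lagBox ⌈β ^ (8 * ε)⌉₊),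
              (r.N : ℝ) - plaquetteObs r.ρ p.1 p.2.1.1 p.2.1.2 η ≤ β ^ (κ / 2 - 1)) →
          ymSpecification (d := 4) r.ρ β (lagBox ⌈β ^ (8 * ε)⌉₊) η (coldEvent r β κ (lagBox ⌈β ^ (8 * ε)⌉₊))ᶜ ≤
            ENNReal.ofReal (Real.exp (-(β ^ (κ / 4)))) →
          c * (⌈β ^ ε⌉₊ : ℝ) ^ 3 * β ^ (-(2 : ℝ)) ≤
            lagCov (coldKernel r β κ ⌈β ^ (8 * ε)⌉₊ η) (softLoopObs r ⌈β ^ ε⌉₊) ⌈β ^ ε⌉₊ := by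
  intro G _ _ _ _ _ _ hG r
  obtain ⟨c, ε₀, κ₁, hc, hε₀, hκ₁, hin⟩ := innerFloor_lineForm G hG r
  obtain ⟨K, a₂, κ₂, hK, ha₂, hκ₂, hE2⟩ := stub_innerDatumMeanSmoothG G hG r
  refine ⟨c / 8, min ε₀ (4 * a₂ / 31), by positivity, lt_min hε₀ (by positivity), fun ε hε hεle => ?_⟩
  have hε₀' : ε ≤ ε₀ := hεle.trans (min_le_left _ _)
  have ha₂' : 31 / 4 * ε ≤ a₂ := by have := hεle.trans (min_le_right _ _); linarith
  have h4 : 4 * ε ≤ 31 / 4 * ε := by linarith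
  set κ : ℝ := min (min κ₁ κ₂) (min (ε / 2) (1 / 2)) with hκdef
  have hκpos : 0 < κ := lt_min (lt_min hκ₁ hκ₂) (lt_min (by positivity) (by norm_num))
  have hκ1 : κ ≤ κ₁ := (min_le_left _ _).trans (min_le_left _ _)
  have hκ2 : κ ≤ κ₂ := (min_le_left _ _).trans (min_le_right _ _)
  have hκε : κ ≤ ε / 2 := (min_le_right _ _).trans (min_le_left _ _)
  have hκlt : κ < 1 := lt_of_le_of_lt ((min_le_right _ _).trans (min_le_right _ _)) (by norm_num)
  have hwin : 13 * ε + 2 * κ < 2 * (31 / 4 * ε) := by linarith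
  have hba : 31 / 4 * ε < 8 * ε := by linarith
  obtain ⟨β₁, hfloor⟩ := hin ε κ hε hε₀' hκpos hκ1 hκε
  obtain ⟨β₂, hsmooth⟩ := hE2 ε (31 / 4 * ε) κ hε h4 ha₂' hκpos hκ2
  obtain ⟨β₃, hout⟩ := coldBoxFloor_of_innerMixture G r ε (31 / 4 * ε) (8 * ε) κ c K hε hκpos hc hwin hba
    ⟨β₁, fun β hβ ζ hgood htyp => hfloor β hβ ζ hgood htyp⟩ ⟨β₂, fun β hβ ζ hgood htyp => hsmooth β hβ ζ hgood htyp⟩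
  exact ⟨κ, β₃, hκpos, by linarith, hκlt, fun β hβ η hgood htyp => hout β hβ η hgood htyp⟩

/-- **The crux T′ (rev 3, stmt-QuantumFields-24180) BY NAME**: the outer line form read through the `rfl`-unfoldings of the crux's `let`s
(`Λ = lagBox n`, `cold = coldEvent r β κ Λ`, `ν = coldKernel r β κ n η`, `F = softLoopObs r R`). -/
theorem ColdBoxSoftLoopLagFloor_of_stubs :
    Summit.QuantumFields.YangMills.Theses.SoftLoopLongLag.ColdBoxSoftLoopLagFloor := by
  intro G _ _ _ _ _ _ hG r
  obtain ⟨c, ε₀, hc, hε₀, h⟩ := coldBoxFloor_lineForm G hG r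
  refine ⟨c, ε₀, hc, hε₀, fun ε hε hεle => ?_⟩
  obtain ⟨κ, β₀, hκ, hκε, hκ1, h'⟩ := h ε hε hεle
  exact ⟨κ, β₀, hκ, hκε, hκ1, fun β hβ η hgood htyp => h' β hβ η hgood htyp⟩

end Summit.QuantumFields.YangMills.Cruxes.ColdBoxSoftLoopLagFloor.Birth

end
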